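import Mathlib
import HarnessLib
import Summits.HubbardSuperconductivity.HubbardSuperconductivity.Theorems.ChiralWindowDefs

/-!
# Route `WeakCouplingBCS` — certificate vocabulary for the support item `WcbcsKohnLuttingerB1g` (stmt-HubbardSuperconductivity-0158)

The item asks for a doping window on which the `B1g` (`d_{x²-y²}`) channel bottom of the second-order Kohn–Luttinger
vertex lies strictly (by `γU²`) below the bottoms of the four other `D₄` channels.  The crux line `Sketch` of the
`ChiralWindow` route (item stmt-…-1741) landed a complete certificate logic for channel bottoms
(`Theorems/ChiralWindowDefs.lean`: the rational record `KLCert` of trigonometric trial/deflation functions `KLTrig`,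
channel blocks `KLBlock` with enclosures `Nlo ≤ ∫Φ² ≤ Nhi`, `Qlo ≤ ⟨Φ, κΦ⟩ ≤ Qhi`, `‖κΦ‖² ≤ Thi`, deflated sector square
mass `≤ Hhi`, boxes `KLBox` of chemical potentials; soundness `stub_klBlockBounds`: `lowerOK → lower ≤ channelInf ε₀ μ 1 χ`
by Temple's inequality or the far-channel bound).  This file only NAMES, on the SAME record type, the two objects the
`WeakCouplingBCS` item needs — nothing is proved here:

* `KLBlock.RitzEnclosure` — the Ritz enclosures E1–E2 of a block (norm and Rayleigh numerator of its trial);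
* `KLBox.basicOKB1g` — the box is well formed, its `B1g` block carries usable Ritz data, and the four other channels have
  a certified lower bound (`lowerOK`: Temple data or far-channel data);
* `KLCert.checkB1g` — the kernel-decidable checker: window ends `-4 < mub < mua < 0`, `gamma > 0`, boxes contiguous and
  covering `[mub, mua]`, and on EVERY box `basicOKB1g ∧ b1gLeadsOK gamma` (`B1g`'s Ritz upper bound `+ gamma ≤` the
  certified lower bound of each other channel);
* `KLCert.EnclosuresB1g` — **the named numerical hypothesis** of this item: on every box, uniformly in `μ`, the Ritz
  enclosures of the `B1g` block and the block enclosures (`KLBlock.Enclosure`, E1–E4) of the four other channels.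

The companion file `WeakCouplingBCSWcbcsKohnLuttingerB1gKlCertForm.lean` proves
`∀ c, c.checkB1g = true → c.EnclosuresB1g → WcbcsKohnLuttingerB1g`.  The fields `cov`, the node data of the boxes and the
`E`-leads clause of `KLCert.check` are simply not read (set them to `0` in a record for this item); the record format and
the JSON→Lean tooling of the `ChiralWindow` line (`Cruxes/CwKLChiralWindow/CertInterface.md`, `klcheck.py`) apply verbatim.
Design: declared in the namespace of `KLCert` (`…Theorems.CwKLChiralWindow`) for dot notation.  References: Reed–Simon IV
Thm. XIII.5 (Temple); S. Raghu, S. A. Kivelson, D. J. Scalapino, Phys. Rev. B 81 (2010) 224505, §II (7), (13), §III Fig. 2.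
-/

noncomputable section

namespace Summit.HubbardSuperconductivity.HubbardSuperconductivity.Theorems.CwKLChiralWindow

set_option linter.dupNamespace false -- summit = problem name (single-conjunct summit), D-0017

open MeasureTheory Literature.MathematicalPhysics.QuantumLattice

/-- **The Ritz enclosures of a block** at the level `μ` (interface E1–E2): with `σ = σ_μ`, `Φ` the block's trial and
`κ` its base kernel (`χ₀(k+k')`, plus `1` if `withU`): `Nlo ≤ ∫Φ² dσ ≤ Nhi` and `Qlo ≤ ∫ Φ(k) (∫ κ(k,k') Φ(k') dσ) dσ ≤ Qhi`.
[folklore] -/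
def KLBlock.RitzEnclosure (b : KLBlock) (tab : List KLTrig) (μ : ℝ) : Prop :=
  (b.Nlo : ℝ) ≤ ∫ k, b.trialFun tab k ^ 2 ∂fermiCurveMeasure (squareDispersion 1 0) μ ∧
  ∫ k, b.trialFun tab k ^ 2 ∂fermiCurveMeasure (squareDispersion 1 0) μ ≤ (b.Nhi : ℝ) ∧
  (b.Qlo : ℝ) ≤ ∫ k, b.trialFun tab k *
      ∫ k', b.baseKernel μ k k' * b.trialFun tab k' ∂fermiCurveMeasure (squareDispersion 1 0) μ
      ∂fermiCurveMeasure (squareDispersion 1 0) μ ∧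
  ∫ k, b.trialFun tab k *
      ∫ k', b.baseKernel μ k k' * b.trialFun tab k' ∂fermiCurveMeasure (squareDispersion 1 0) μ
      ∂fermiCurveMeasure (squareDispersion 1 0) μ ≤ (b.Qhi : ℝ)

/-- The box is well formed (`-4 < mulo ≤ muhi < 0`), its `B1g` block has usable Ritz data (`ritzOK`: trial in the
`B1g` harmonic pattern, `0 < Nlo ≤ Nhi`, `Qlo ≤ Qhi < 0`, no bare-`U` term), and each of `A1g, A2g, B2g, E` has a certified
lower bound (`lowerOK`). [folklore] -/
def KLBox.basicOKB1g (bx : KLBox) (tab : List KLTrig) : Bool :=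
  decide (-4 < bx.mulo) && decide (bx.mulo ≤ bx.muhi) && decide (bx.muhi < 0) &&
    bx.bB1g.ritzOK tab .B1g &&
    bx.bA1g.lowerOK tab .A1g && bx.bA2g.lowerOK tab .A2g && bx.bB2g.lowerOK tab .B2g && bx.bE.lowerOK tab .E

/-- **The checker for `B1g` dominance on a window.** Window ends `-4 < mub < mua < 0`, margin `gamma > 0`; the boxes
are non-empty, contiguous (`chainOK`) and cover `[mub, mua]`; on every box `basicOKB1g` and `b1gLeadsOK gamma`
(`upper(B1g) + gamma ≤ lower(χ)` for the four other channels).  Kernel-decidable (`decide +kernel`). [folklore] -/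
def KLCert.checkB1g (c : KLCert) : Bool :=
  decide (-4 < c.mub) && decide (c.mub < c.mua) && decide (c.mua < 0) && decide (0 < c.gamma) &&
    (match c.boxes.head?, c.boxes.getLast? with
      | some b₀, some b₁ => decide (b₀.mulo ≤ c.mub) && decide (c.mua ≤ b₁.muhi)
      | _, _ => false) &&
    KLCert.chainOK c.boxes &&
    (c.boxes.all fun bx => bx.basicOKB1g c.trials && bx.b1gLeadsOK c.trials c.gamma)

/-- **The named numerical hypothesis of the item** (certified interval arithmetic): on every box of the record and for
every `μ` in the box, the Ritz enclosures E1–E2 of the `B1g` block and the block enclosures E1–E4 (`KLBlock.Enclosure`) of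
the blocks of `A1g, A2g, B2g, E`.  Every conjunct is an inequality between an explicit integral against the tree's
Fermi-curve measure and a rational of the record. [folklore] -/
def KLCert.EnclosuresB1g (c : KLCert) : Prop :=
  ∀ bx ∈ c.boxes, ∀ μ ∈ Set.Icc (bx.mulo : ℝ) (bx.muhi : ℝ),
    bx.bB1g.RitzEnclosure c.trials μ ∧
      ∀ χ : D4Irrep, χ ≠ D4Irrep.B1g → (bx.blk χ).Enclosure c.trials μ χ

/-! ### The symmetry-multiplicity form of the far-channel test (margin-2, window records)

On the `E` sector every eigenvalue of the (deflated) sector operator is a doublet (the quarter turn `rot` is an isometry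
commuting with the kernel operator and `⟪v, v ∘ rot⟫ = 0` on odd `v`: the tree's `doublet_of_isometry` /
`stub_klChannelOps`), so the negative square mass `Σ λ² ≤ Hhi` forces `2 λ_min² ≤ Hhi`, i.e. `λ_min ≥ -√(Hhi/2)`: the
far-channel bound `-s` is certified as soon as `Hhi ≤ dmult χ · s²` (`dmult E = 2`, else `1`).  The checker below differs
from `KLCert.checkB1g` ONLY in this test; the numerical hypothesis `KLCert.EnclosuresB1g` is unchanged. -/

/-- The far-channel data are usable with the symmetry multiplicity: admissible deflation, `0 ≤ s`,
`Hhi ≤ dmult χ · s²` (`dmult E = 2`: the `E` levels are doublets; `dmult χ = 1` otherwise, then this is `farOK`), and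
`withU` only for `A1g`. [folklore] -/
def KLBlock.farOKd (b : KLBlock) (tab : List KLTrig) (χ : D4Irrep) : Bool :=
  b.deflOK tab χ && decide (0 ≤ b.s) && decide (b.Hhi ≤ KLBlock.dmult χ * b.s ^ 2) &&
    (!b.withU || decide (χ = D4Irrep.A1g))

/-- A certified lower bound for the channel bottom is available, the far-channel test read with the symmetry
multiplicity: Temple data or `farOKd`; the bound itself is `KLBlock.lower` (Temple's value, else `-s`). [folklore] -/
def KLBlock.lowerOKd (b : KLBlock) (tab : List KLTrig) (χ : D4Irrep) : Bool := b.templeOK tab χ || b.farOKd tab χ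

/-- `KLBox.basicOKB1g` with the multiplicity-aware lower-bound test `lowerOKd` for `A1g, A2g, B2g, E`: the box is well
formed (`-4 < mulo ≤ muhi < 0`), its `B1g` block has usable Ritz data, and each other channel has a certified lower bound.
[folklore] -/
def KLBox.basicOKB1gD (bx : KLBox) (tab : List KLTrig) : Bool :=
  decide (-4 < bx.mulo) && decide (bx.mulo ≤ bx.muhi) && decide (bx.muhi < 0) &&
    bx.bB1g.ritzOK tab .B1g &&
    bx.bA1g.lowerOKd tab .A1g && bx.bA2g.lowerOKd tab .A2g && bx.bB2g.lowerOKd tab .B2g && bx.bE.lowerOKd tab .E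

/-- **The checker for `B1g` dominance on a window, multiplicity-aware form** (`KLCert.checkB1g` with `basicOKB1gD` in
place of `basicOKB1g`): window ends `-4 < mub < mua < 0`, `gamma > 0`, boxes non-empty, contiguous and covering
`[mub, mua]`, and on every box `basicOKB1gD ∧ b1gLeadsOK gamma`.  Kernel-decidable (`decide +kernel`). [folklore] -/
def KLCert.checkB1gD (c : KLCert) : Bool :=
  decide (-4 < c.mub) && decide (c.mub < c.mua) && decide (c.mua < 0) && decide (0 < c.gamma) &&
    (match c.boxes.head?, c.boxes.getLast? with
      | some b₀, some b₁ => decide (b₀.mulo ≤ c.mub) && decide (c.mua ≤ b₁.muhi)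
      | _, _ => false) &&
    KLCert.chainOK c.boxes &&
    (c.boxes.all fun bx => bx.basicOKB1gD c.trials && bx.b1gLeadsOK c.trials c.gamma)

end Summit.HubbardSuperconductivity.HubbardSuperconductivity.Theorems.CwKLChiralWindow

end
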